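import Summits.QuantumFields.YangMills.Theorems.UnitScaleTiltProp7SectET3BgClass
import Literature.MathematicalPhysics.QuantumFieldTheory.Balaban1983to89.B9Thm37GpTorusRegularEntries
import HarnessLib

/-!
# Route `UnitScaleTilt`, crux «MinimiserStabilityRegPr» (stmt-QuantumFields-19200, v10 stub EX, route (α), node N06(d = 3)) — OWNER W-SEAT MAP #3 row M16:
# **lit-balaban's ✓ p600116 `B9Thm37GpTorusRegularEntries.eBlock_kernelFamilySInv_Gp_of_cubes` — [Balaban1985BackgroundPropagators] Theorem 3.7 ⇒ ALL FOUR INEQUALITIES (3.42)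
# FOR THE SITE-SECTOR PROPAGATOR `G′(U)` — READ AT THE T³ MEMBERS** (`d + 1 = 3`, `𝔸 := M₂(ℂ)`, backgrounds `bgT3 i`, class map THE IDENTITY, background `cfgV1OfT3 U₀` of the
# route's SU(2) field; per-cube inputs displayed)

Cell `ym3-torus` (HUMAN RULING D-0037, YM ladder rung R3 — NOT the Clay problem), width seat ym-ust-20520-w1 g3.  Count-neutral helper (`--supports stmt-QuantumFields-19200 --as
helper`); registry untouched; THEOREMS ONLY (0 `def`, 0 `sorry`); NOTHING of [Balaban1985BackgroundPropagators] is asserted — every analytic input is a displayed per-cube hypothesis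
of the Literature theorem, passed through.

THE PRINT (p. 397 (3.42); p. 409 Thm 3.7; p. 410 «Theorem 3.7 implies that all the inequalities (3.42)–(3.47) hold for G′»; [Balaban1984PropagatorsII] Prop. 2.2 (2.64)–(2.67) p. 234).

THE JUNCTION.  `Node00.CfgY 𝔸 i := CfgV1 (PV d ℓ i.m i.K hd hL) 𝔸` and `(bgT3 i).Cfg = (bg9K M₂(ℂ) SU(2)ˣ i).Cfg := CfgV1 (PV 2 ℓ i.m i.K hd3 hL) M₂(ℂ)` are the SAME type, so the
Literature theorem's class map `cfg : B.Cfg → CfgY 𝔸 i` is THE IDENTITY at `B := bgT3 i` and the kernel family `kernelFamilySInv i (bgT3 i) (fun U ↦ U) O par : B9.KernelFamily (geo9K i)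
(bgT3 i)` has exactly the type of the T³ leaves' kernel-family slots (`Prop7SectET3N06Leaves(CoGlob)`); the route's SU(2) field `U₀` enters as `U₁ := cfgV1OfT3 U₀` (★w1 g2's reading,
`Prop7SectET3BgClass`).
WHERE IT SITS (located, OWNER bus 2026-08-28 M16 note).  This is the SITE sector of Sects. A–C (`SiteOpY`: operators on `SiteY i → 𝔸`); the T³ leaf's displayed XL item `Thm33G0` is
Theorem 3.3 for Sect. D's BOND-sector `G₀ = (Δ + DRD* + Q*aQ)⁻¹` (p. 421), supplied in Track A by Theorem 3.10's sum (`B9Thm312WholeFromThm310.thm33G0_of_conv3107`).  The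
site-sector `G′(U)` enters Sect. D through `R(U) = G′Q′*(Q′G′²Q′*)⁻¹Q′G′` and (3.49) for `P = I − R` (the `R ∕ D_v ∕ D_v*` letters of `Letters313.rgd1∕rgd2`, `Letters313D.rgdH`), and
enters COV through the [Balaban1985RegularSpaces] Theorem-2 chain (`B8Thm2TorusLetters.LettersAt`).  So this file is the T³ junction for those two consumers — NOT a discharge of
`Thm33G0`.

WHAT IS PROVED.  ★★ `eBlock_Gp_T3_of_cubes` — `eBlock_kernelFamilySInv_Gp_of_cubes` at `(d, hd, 𝔸, B, cfg) := (2, hd3, M₂(ℂ), bgT3 i, id)`, every per-cube input displayed VERBATIM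
(`hT hcnt h389 hcnt' hTE hKE hTL hKL hTF hKF hV hKV hinv h388 h388T`, [4] Lemma 2.1 `h261 h263`, the two located smallness conditions), the background an ARBITRARY `U₁ : (bgT3 i).Cfg`;
`eBlock_Gp_T3_of_cubes_cfgV1OfT3` — the same at `U₁ := cfgV1OfT3 U₀`.  HONEST SCOPE: a by-name port (one `exact`); no estimate; nothing here claims EX, the crux, V3∕R3, d = 4 or the
mass gap; YM₃ on T³ is ladder rung R3, not the Clay problem.

References: T. Bałaban, CMP **99** (1985) 389–434 [Balaban1985BackgroundPropagators] ((3.42) p.397, Thm 3.7 (3.87)–(3.90) pp.409–410, (3.49) p.399, p.421); CMP **96** (1984) 223–250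
[Balaban1984PropagatorsII] (Prop. 2.2 (2.64)–(2.67) p.234, Lemma 2.1 (2.60)–(2.61) p.234).
-/

set_option autoImplicit false

noncomputable section

open scoped Matrix.Norms.L2Operator Matrix

namespace Summit.QuantumFields.YangMills.Theorems.Prop7SectET3GpEntries

open Literature.MathematicalPhysics.QuantumFieldTheory.Balaban1983to89
open Literature.MathematicalPhysics.QuantumFieldTheory.Balaban1983to89.Node00
open Literature.MathematicalPhysics.QuantumFieldTheory.Balaban1983to89.B9CubeLettersInvReadings (kernelFamilySInv)
open Literature.MathematicalPhysics.QuantumFieldTheory.Balaban1983to89.B9Thm37GpTorusRegularEntries (eBlock_kernelFamilySInv_Gp_of_cubes)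
open Literature.MathematicalPhysics.QuantumFieldTheory.Balaban1983to89.B6KLevelCensusIndexV1 (KIdx)
open Literature.MathematicalPhysics.QuantumFieldTheory.Balaban1983to89.B6GlobalChartV1 (PV)
open Literature.MathematicalPhysics.QuantumFieldTheory.Balaban1983to89.B6Geom246MultiLevelBox (blkOf)
open Literature.MathematicalPhysics.QuantumFieldTheory.Balaban1983to89.B6Ineq2142KLevelV1 (β)
open Literature.MathematicalPhysics.QuantumFieldTheory.Balaban1983to89.B6RandomWalk (HasMajorant Ineq261 Ineq263)
open Literature.MathematicalPhysics.QuantumFieldTheory.Balaban1983to89.B9Thm34Ext (toB6)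
open Literature.MathematicalPhysics.QuantumFieldTheory.Balaban1983to89.B9GeoNormsKLevelV1 (geo9K)
open Literature.MathematicalPhysics.QuantumFieldTheory.Balaban1983to89.B9Eq352DivFormLetters (conj)
open Literature.MathematicalPhysics.QuantumFieldTheory.Balaban1983to89.B9Eq352GradLetters (diffLetter)
open Literature.MathematicalPhysics.QuantumFieldTheory.Balaban1983to89.B9FromB6 (EBlock)
open Summit.QuantumFields.YangMills.Theorems.Prop7SectET3Members (hd3)
open Summit.QuantumFields.YangMills.Theorems.Prop7SectET3BgClass (bgT3 cfgV1OfT3)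

variable {ℓ : ℕ} {hL : Odd (ℓ + 1) ∧ 1 < ℓ + 1} {b₀ b₁ : ℝ}
variable {ι : Type} [Fintype ι] [DecidableEq ι]

/-- ★★ **THEOREM 3.7 ⇒ ALL FOUR INEQUALITIES (3.42) FOR THE SITE-SECTOR `G′(U)` AT A T³ MEMBER** — lit-balaban's `eBlock_kernelFamilySInv_Gp_of_cubes` (✓ p600116) read at
`d + 1 = 3`, `𝔸 := M₂(ℂ)`, `B := bgT3 i`, CLASS MAP THE IDENTITY (`(bgT3 i).Cfg = CfgY M₂(ℂ) i` definitionally), at an ARBITRARY member background `U₁`.  Per-cube inputs displayed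
VERBATIM: FILE 1's first entry (`hT`, `hcnt`), the (3.89) factors (`h389`, `hcnt'`), the forward∕Laplacian∕backward cube entries with their summed bounds (`hTE`∕`hKE`, `hTL`∕`hKL`,
`hTF`∕`hKF`), the transposed (3.88) data (`hV`∕`hKV`, `h388T`), `hinv`, `h388`, [4] Lemma 2.1 at exponent `α` (`h261`, `h263`) and the two located smallness conditions («for M
sufficiently large»); coordinates through a real basis `b` of `M₂(ℂ)` with bound `M₂`, corner-free section `ιB` of `β`.  Conclusion: the (3.42) block
`EBlock (kernelFamilySInv i (bgT3 i) (fun U ↦ U) O par) (M₂(Σ‖b_j‖)·Bc) ((1−2α)δ₀) U₁` with lit-balaban's sum constant `Bc`.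
[cite: Balaban1985BackgroundPropagators, Thm 3.1 (3.42) p.397 via Thm 3.7 pp.409–410; Balaban1984PropagatorsII, Prop 2.2 (2.67) p.234] -/
theorem eBlock_Gp_T3_of_cubes (i : KIdx 2 ℓ hd3 hL b₀ b₁) (b : Module.Basis ι ℝ (Matrix (Fin 2) (Fin 2) ℂ))
    [Fintype (geo9K i).Site] [DecidableEq (geo9K i).Site] {Rr : ℝ} {Hp : Prop} (ιB : BlkY i → IBondY i)
    (O : SiteOpY (Matrix (Fin 2) (Fin 2) ℂ) i) (par : SiteParY (Matrix (Fin 2) (Fin 2) ℂ) i) {U₁ : (bgT3 i).Cfg}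
    (hι : ∀ s, β i.hN i.D i.hk (ιB s) = s)
    {M₂ : ℝ} (hM₂ : 0 ≤ M₂) (hrepr : ∀ (v : Matrix (Fin 2) (Fin 2) ℂ) (j : ι), |b.repr v j| ≤ M₂ * ‖v‖)
    {Uc : Fin (2 + 1) → SiteY i → (Matrix (Fin 2) (Fin 2) ℂ)ˣ} (hUc : Uc = UboxY i U₁)
    (Lap : Module.End ℝ (SiteY i → Matrix (Fin 2) (Fin 2) ℂ)) (hLap : ∀ Λ, Lap Λ = lapS i U₁ Λ)
    (d' : ℕ) {δ₀ α θ θV B₀ N N' A₁ A₂ A₃ : ℝ} {κ : Type} [Fintype κ]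
    (S S' : κ → Finset (geo9K i).Site) {Δ : Module.End ℝ (SiteY i → Matrix (Fin 2) (Fin 2) ℂ)} (T R V : κ → Module.End ℝ (SiteY i → Matrix (Fin 2) (Fin 2) ℂ))
    (KE KF : Fin (2 + 1) → κ → (geo9K i).Site → (geo9K i).Site → ℝ) (KL KV : κ → (geo9K i).Site → (geo9K i).Site → ℝ)
    (hB₀ : 0 ≤ B₀) (hθ : 0 ≤ θ) (hθV : 0 ≤ θV) (hN : 0 ≤ N) (hN' : 0 ≤ N') (hA₁ : 0 ≤ A₁) (hA₂ : 0 ≤ A₂) (hA₃ : 0 ≤ A₃)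
    (hαδ : 0 ≤ α * δ₀) (hαδ2 : 0 ≤ (1 - 2 * α) * δ₀)
    (h261 : Ineq261 d' (toB6 (geo9K i) Rr Hp) δ₀ α) (h263 : Ineq263 d' (toB6 (geo9K i) Rr Hp) δ₀ α)
    (hsmall : N' * θ * B6.c1 d' δ₀ α < 1) (hsmallV : θV * B6.c1 d' δ₀ α < 1)
    (hT : ∀ k, HasMajorant (g := toB6 (geo9K i) Rr Hp) (fun p : SiteY i × ι => ιB (blkOf i.D.toDomains p.1))
      (conj b ((etaS i ^ 2) • T k))
      (fun a a' => if a ∈ S k then B₀ * (geo9K i).len a ^ 2 * Real.exp (-(δ₀ * (geo9K i).dist a a')) else 0))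
    (hcnt : ∀ a : (geo9K i).Site, (∑ k, if a ∈ S k then (1 : ℝ) else 0) ≤ N)
    (h389 : ∀ k, HasMajorant (g := toB6 (geo9K i) Rr Hp) (fun p : SiteY i × ι => ιB (blkOf i.D.toDomains p.1)) (conj b (R k))
      (fun a a' => if a ∈ S' k then θ * Real.exp (-(δ₀ * (geo9K i).dist a a')) else 0))
    (hcnt' : ∀ a : (geo9K i).Site, (∑ k, if a ∈ S' k then (1 : ℝ) else 0) ≤ N')
    (hTE : ∀ μ k, HasMajorant (g := toB6 (geo9K i) Rr Hp) (fun p : SiteY i × ι => ιB (blkOf i.D.toDomains p.1))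
      (conj b (diffLetter (shiftY i) Uc (((etaS i : ℂ))⁻¹) (Sum.inl μ)) * conj b ((etaS i ^ 2) • T k)) (KE μ k))
    (hKE : ∀ μ a a', (∑ k, KE μ k a a') ≤ A₁ * (geo9K i).len a * Real.exp (-(δ₀ * (geo9K i).dist a a')))
    (hTL : ∀ k, HasMajorant (g := toB6 (geo9K i) Rr Hp) (fun p : SiteY i × ι => ιB (blkOf i.D.toDomains p.1))
      (conj b ((etaS i ^ 2)⁻¹ • Lap) * conj b ((etaS i ^ 2) • T k)) (KL k))
    (hKL : ∀ a a', (∑ k, KL k a a') ≤ A₃ * 1 * Real.exp (-(δ₀ * (geo9K i).dist a a')))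
    (hTF : ∀ μ k, HasMajorant (g := toB6 (geo9K i) Rr Hp) (fun p : SiteY i × ι => ιB (blkOf i.D.toDomains p.1))
      (conj b ((etaS i ^ 2) • T k) * conj b (diffLetter (shiftY i) Uc (((etaS i : ℂ))⁻¹) (Sum.inr μ))) (KF μ k))
    (hKF : ∀ μ a a', (∑ k, KF μ k a a') ≤ A₂ * (geo9K i).len a * Real.exp (-(δ₀ * (geo9K i).dist a a')))
    (hV : ∀ k, HasMajorant (g := toB6 (geo9K i) Rr Hp) (fun p : SiteY i × ι => ιB (blkOf i.D.toDomains p.1)) (conj b (V k)) (KV k))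
    (hKV : ∀ a a', (∑ k, KV k a a') ≤ θV * (geo9K i).len a * ((geo9K i).len a')⁻¹ * Real.exp (-(δ₀ * (geo9K i).dist a a')))
    (hinv : (O U₁).restrictScalars ℝ * Δ = 1) (h388 : Δ * (∑ k, T k) = 1 - ∑ k, R k) (h388T : (∑ k, T k) * Δ = 1 - ∑ k, V k) :
    EBlock (kernelFamilySInv i (bgT3 i) (fun U => U) O par)
      (M₂ * (∑ j, ‖b j‖) *
        (N * B₀ * B6.c1 d' δ₀ α * (1 - N' * θ * B6.c1 d' δ₀ α)⁻¹ + A₁ * B6.c1 d' δ₀ α * (1 - N' * θ * B6.c1 d' δ₀ α)⁻¹ +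
          A₂ * B6.c1 d' δ₀ α * (1 - θV * B6.c1 d' δ₀ α)⁻¹ + A₃ * B6.c1 d' δ₀ α * (1 - N' * θ * B6.c1 d' δ₀ α)⁻¹))
      ((1 - 2 * α) * δ₀) U₁ :=
  eBlock_kernelFamilySInv_Gp_of_cubes (B := bgT3 i) (U₁ := U₁) i b ιB (fun U => U) O par hι hM₂ hrepr hUc Lap hLap d' S S' T R V KE KF KL KV hB₀ hθ hθV hN hN' hA₁ hA₂ hA₃ hαδ hαδ2 h261 h263
    hsmall hsmallV hT hcnt h389 hcnt' hTE hKE hTL hKL hTF hKF hV hKV hinv h388 h388T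

/-- **The same at the route's SU(2) field**: `U₁ := cfgV1OfT3 U₀` for `U₀ : GaugeField (PV 2 ℓ i.m i.K) 0 SU(2)` (★w1 g2's V1 reading; the member's torus `F.P K = PV 2 ℓ F.m K`).
[cite: Balaban1985BackgroundPropagators, Thm 3.1 (3.42) p.397 via Thm 3.7 pp.409–410] -/
theorem eBlock_Gp_T3_of_cubes_cfgV1OfT3 (i : KIdx 2 ℓ hd3 hL b₀ b₁) (b : Module.Basis ι ℝ (Matrix (Fin 2) (Fin 2) ℂ))
    [Fintype (geo9K i).Site] [DecidableEq (geo9K i).Site] {Rr : ℝ} {Hp : Prop} (ιB : BlkY i → IBondY i)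
    (O : SiteOpY (Matrix (Fin 2) (Fin 2) ℂ) i) (par : SiteParY (Matrix (Fin 2) (Fin 2) ℂ) i)
    (U₀ : GaugeField (PV 2 ℓ i.m i.K hd3 hL) 0 (Matrix.specialUnitaryGroup (Fin 2) ℂ))
    (hι : ∀ s, β i.hN i.D i.hk (ιB s) = s)
    {M₂ : ℝ} (hM₂ : 0 ≤ M₂) (hrepr : ∀ (v : Matrix (Fin 2) (Fin 2) ℂ) (j : ι), |b.repr v j| ≤ M₂ * ‖v‖)
    {Uc : Fin (2 + 1) → SiteY i → (Matrix (Fin 2) (Fin 2) ℂ)ˣ} (hUc : Uc = UboxY i (cfgV1OfT3 U₀))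
    (Lap : Module.End ℝ (SiteY i → Matrix (Fin 2) (Fin 2) ℂ)) (hLap : ∀ Λ, Lap Λ = lapS i (cfgV1OfT3 U₀) Λ)
    (d' : ℕ) {δ₀ α θ θV B₀ N N' A₁ A₂ A₃ : ℝ} {κ : Type} [Fintype κ]
    (S S' : κ → Finset (geo9K i).Site) {Δ : Module.End ℝ (SiteY i → Matrix (Fin 2) (Fin 2) ℂ)} (T R V : κ → Module.End ℝ (SiteY i → Matrix (Fin 2) (Fin 2) ℂ))
    (KE KF : Fin (2 + 1) → κ → (geo9K i).Site → (geo9K i).Site → ℝ) (KL KV : κ → (geo9K i).Site → (geo9K i).Site → ℝ)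
    (hB₀ : 0 ≤ B₀) (hθ : 0 ≤ θ) (hθV : 0 ≤ θV) (hN : 0 ≤ N) (hN' : 0 ≤ N') (hA₁ : 0 ≤ A₁) (hA₂ : 0 ≤ A₂) (hA₃ : 0 ≤ A₃)
    (hαδ : 0 ≤ α * δ₀) (hαδ2 : 0 ≤ (1 - 2 * α) * δ₀)
    (h261 : Ineq261 d' (toB6 (geo9K i) Rr Hp) δ₀ α) (h263 : Ineq263 d' (toB6 (geo9K i) Rr Hp) δ₀ α)
    (hsmall : N' * θ * B6.c1 d' δ₀ α < 1) (hsmallV : θV * B6.c1 d' δ₀ α < 1)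
    (hT : ∀ k, HasMajorant (g := toB6 (geo9K i) Rr Hp) (fun p : SiteY i × ι => ιB (blkOf i.D.toDomains p.1))
      (conj b ((etaS i ^ 2) • T k))
      (fun a a' => if a ∈ S k then B₀ * (geo9K i).len a ^ 2 * Real.exp (-(δ₀ * (geo9K i).dist a a')) else 0))
    (hcnt : ∀ a : (geo9K i).Site, (∑ k, if a ∈ S k then (1 : ℝ) else 0) ≤ N)
    (h389 : ∀ k, HasMajorant (g := toB6 (geo9K i) Rr Hp) (fun p : SiteY i × ι => ιB (blkOf i.D.toDomains p.1)) (conj b (R k))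
      (fun a a' => if a ∈ S' k then θ * Real.exp (-(δ₀ * (geo9K i).dist a a')) else 0))
    (hcnt' : ∀ a : (geo9K i).Site, (∑ k, if a ∈ S' k then (1 : ℝ) else 0) ≤ N')
    (hTE : ∀ μ k, HasMajorant (g := toB6 (geo9K i) Rr Hp) (fun p : SiteY i × ι => ιB (blkOf i.D.toDomains p.1))
      (conj b (diffLetter (shiftY i) Uc (((etaS i : ℂ))⁻¹) (Sum.inl μ)) * conj b ((etaS i ^ 2) • T k)) (KE μ k))
    (hKE : ∀ μ a a', (∑ k, KE μ k a a') ≤ A₁ * (geo9K i).len a * Real.exp (-(δ₀ * (geo9K i).dist a a')))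
    (hTL : ∀ k, HasMajorant (g := toB6 (geo9K i) Rr Hp) (fun p : SiteY i × ι => ιB (blkOf i.D.toDomains p.1))
      (conj b ((etaS i ^ 2)⁻¹ • Lap) * conj b ((etaS i ^ 2) • T k)) (KL k))
    (hKL : ∀ a a', (∑ k, KL k a a') ≤ A₃ * 1 * Real.exp (-(δ₀ * (geo9K i).dist a a')))
    (hTF : ∀ μ k, HasMajorant (g := toB6 (geo9K i) Rr Hp) (fun p : SiteY i × ι => ιB (blkOf i.D.toDomains p.1))
      (conj b ((etaS i ^ 2) • T k) * conj b (diffLetter (shiftY i) Uc (((etaS i : ℂ))⁻¹) (Sum.inr μ))) (KF μ k))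
    (hKF : ∀ μ a a', (∑ k, KF μ k a a') ≤ A₂ * (geo9K i).len a * Real.exp (-(δ₀ * (geo9K i).dist a a')))
    (hV : ∀ k, HasMajorant (g := toB6 (geo9K i) Rr Hp) (fun p : SiteY i × ι => ιB (blkOf i.D.toDomains p.1)) (conj b (V k)) (KV k))
    (hKV : ∀ a a', (∑ k, KV k a a') ≤ θV * (geo9K i).len a * ((geo9K i).len a')⁻¹ * Real.exp (-(δ₀ * (geo9K i).dist a a')))
    (hinv : (O (cfgV1OfT3 U₀)).restrictScalars ℝ * Δ = 1) (h388 : Δ * (∑ k, T k) = 1 - ∑ k, R k) (h388T : (∑ k, T k) * Δ = 1 - ∑ k, V k) :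
    EBlock (kernelFamilySInv i (bgT3 i) (fun U => U) O par)
      (M₂ * (∑ j, ‖b j‖) *
        (N * B₀ * B6.c1 d' δ₀ α * (1 - N' * θ * B6.c1 d' δ₀ α)⁻¹ + A₁ * B6.c1 d' δ₀ α * (1 - N' * θ * B6.c1 d' δ₀ α)⁻¹ +
          A₂ * B6.c1 d' δ₀ α * (1 - θV * B6.c1 d' δ₀ α)⁻¹ + A₃ * B6.c1 d' δ₀ α * (1 - N' * θ * B6.c1 d' δ₀ α)⁻¹))
      ((1 - 2 * α) * δ₀) (cfgV1OfT3 U₀) :=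
  eBlock_Gp_T3_of_cubes (U₁ := cfgV1OfT3 U₀) i b ιB O par hι hM₂ hrepr hUc Lap hLap d' S S' T R V KE KF KL KV hB₀ hθ hθV hN hN' hA₁ hA₂ hA₃ hαδ hαδ2 h261 h263
    hsmall hsmallV hT hcnt h389 hcnt' hTE hKE hTL hKL hTF hKF hV hKV hinv h388 h388T

end Summit.QuantumFields.YangMills.Theorems.Prop7SectET3GpEntries

end
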